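import Summits.QuantumFields.YangMills.Theorems.BalabanUVNodesK1V6Defs
open Literature.MathematicalPhysics.QuantumFieldTheory.Balaban1983to89
open Literature.MathematicalPhysics.QuantumFieldTheory.Balaban1983to89.T4Continuum
/-!
# K1⁷ (stmt-QuantumFields-20542) — U1 per letter, γ addendum (IDEA-2 g15): γ IS READ BY THE β OF RECORD ONLY AS THE BOX `]0,γ]^{k+1}`
(BetaOfRecord.lean :198).  (i) inside the smaller box the γ-move leaves β unchanged; (ii) off the box β is the γ-free one-loop number.
Consequence stated (not typed here): node O's v6 run rows, keyed to an ∃-level `γ₀` and read on in-window histories, are hereditary under γ ↓.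
Bookkeeping only; nothing of Bałaban asserted; K1⁷ OPEN; R4 = the CONDITIONAL finite-𝕋⁴ rung `BalabanLadder.UV` only — not the YM mass gap, not Clay.
-/
namespace Summit.QuantumFields.YangMills.Cruxes.StabilityBAtRecordR13SepCoPH.Idea2g15GammaBox
variable {F : T4Family}
def setGamma (θ : Node00.Stage13HParams F 2) (g : ℝ) : Node00.Stage13HParams F 2 := { θ with γ := g }

/-- γ IS ONLY THE BOX (i): on histories inside the smaller box the β of record is unchanged by the γ-move (both sides = β_merged). -/
theorem betaOfRecord₁₃_setGamma_of_mem (θ : Node00.Stage13HParams F 2) {γ' : ℝ} (hγ : γ' ≤ θ.γ) {k : ℕ} {v : Fin (k + 1) → ℝ}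
    (hv : v ∈ FlowStep.Box γ' k) :
    Node00.betaOfRecord₁₃ F 2 (setGamma θ γ').toStage13Params k v = Node00.betaOfRecord₁₃ F 2 θ.toStage13Params k v := by
  have hv' : v ∈ FlowStep.Box θ.γ k :=
    FlowStep.mem_box.mpr fun i => ⟨(FlowStep.mem_box.mp hv i).1, (FlowStep.mem_box.mp hv i).2.trans hγ⟩
  dsimp only [Node00.betaOfRecord₁₃, Node00.betaOfRecord₈Tχ, Node00.chiβOfRecord₁₃, setGamma]
  rw [Node00.betaOfMerged_of_mem _ _ _ hv, Node00.betaOfMerged_of_mem _ _ _ hv']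

/-- γ IS ONLY THE BOX (ii): off the new box the β of record is the one-loop number, which is γ-FREE — it equals the old record's value off the OLD box. -/
theorem betaOfRecord₁₃_setGamma_of_notMem (θ : Node00.Stage13HParams F 2) (γ' : ℝ) {k : ℕ} {v w : Fin (k + 1) → ℝ}
    (hv : v ∉ FlowStep.Box γ' k) (hw : w ∉ FlowStep.Box θ.γ k) :
    Node00.betaOfRecord₁₃ F 2 (setGamma θ γ').toStage13Params k v = Node00.betaOfRecord₁₃ F 2 θ.toStage13Params k w := by
  dsimp only [Node00.betaOfRecord₁₃, Node00.betaOfRecord₈Tχ, Node00.chiβOfRecord₁₃, setGamma]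
  rw [Node00.betaOfMerged_of_notMem _ _ _ hv, Node00.betaOfMerged_of_notMem _ _ _ hw]
end Summit.QuantumFields.YangMills.Cruxes.StabilityBAtRecordR13SepCoPH.Idea2g15GammaBox
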